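import Summits.QuantumFields.YangMills.Theorems.ColdStartUniversalityLatticeLangevinDossSussmannSmoothingPrep
import HarnessLib

/-!
# Route `ColdStartUniversality` (fixed-cut-off SZZ dynamics; Doss–Sussmann smoothing programme, file 5):
# ★★★ `P_t(C¹) ⊂ C¹` — THE SZZ SEMIGROUP PRESERVES `C¹` CYLINDER FUNCTIONS (every `L`, `β`, `t`)

Helper file (seat `ym-line-csu-p1`, g24).  ★★★ `markovTransition_contDiff_one`: for the SZZ lattice Langevin dynamics on
`SU(2)^E` (`d = 3`, any torus size `L`, any coupling `β`, any time `t ≥ 0`) realised by a regular solution family `U`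
(with the free family `B` on the same flat noise), and every `C¹` function `f` of the ambient matrix coordinates, there
is a `C¹` function `g` of the ambient coordinates with

  `𝔼 f(coords U^x_t) = g(coords x)`   for every `x ∈ SU(2)^E`,

i.e. the transition operator maps `C¹` cylinder functions to `C¹` cylinder functions.  This is the spatial-regularity
input («XL-infra wall», memos g22 §3(c) / g23 §3 N3) for backward-Kolmogorov / Bakry–Émery arguments at fixed cut-off.
Proof: Doss–Sussmann — `U^x_t = B_t · Φ^{B}(coords x)(1)` with `Φ^c` the flow of the tamed path-driven ODE, `C^∞` in
the start with derivative bound `e^{tK}` UNIFORM in the Brownian path (files 1–2); compose with the smooth retraction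
`R` (file 3) so that only GROUP points are ever fed to the dynamics (measurability from the solution family itself);
differentiate under the expectation (`hasFDerivAt_integral_of_dominated_of_fderiv_le`, measurability of the
`ω`-dependent derivative from difference quotients, file 4); glue with the cut-off `χ`.
THEOREMS ONLY, no sorry.  HONEST FRAMING: fixed-cut-off regularity; the constant in the derivative bound is not
explicit; nothing K-uniform; no crux, rung or summit statement is proved; the Yang–Mills mass gap is NOT proved.
-/

set_option autoImplicit false

noncomputable section

namespace Summit.QuantumFields.YangMills.Theorems.ColdStartUniversality

open MeasureTheory Finset Filter Set Metric Function unitInterval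
open scoped NNReal Matrix Topology
open Literature.MathematicalPhysics.QuantumFieldTheory Literature.Analysis.ODE
open Literature.MathematicalPhysics.QuantumLattice (fundamentalRep fundamentalLatticeRep continuous_fundamentalRep
  fundamentalRep_mem_unitaryGroup)

variable {L : ℕ}

/-- The matrix coordinates `x ↦ (e, k, l) ↦ ρ(x_e)_{kl}` of a group configuration are continuous. [folklore] -/
theorem continuous_coordsRho [NeZero L] :
    Continuous fun (x : GaugeConfig 3 L (Matrix.specialUnitaryGroup (Fin 2) ℂ)) (e : Edge 3 L)
      (k l : Fin (fundamentalLatticeRep 2).N) => (fundamentalLatticeRep 2).ρ (x e) k l :=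
  continuous_pi fun e => continuous_pi fun k => continuous_pi fun l =>
    (((fundamentalLatticeRep 2).continuous.comp (continuous_apply e))).matrix_elem k l

/-- ★★★ **`P_t(C¹) ⊂ C¹` for the SZZ dynamics at fixed cut-off.**  Let `B` (free, `β = 0`) and `U` (coupling `β`) be
regular solution families of the SZZ lattice Langevin SDE on `SU(2)^E` driven by the same flat noise, `t ≥ 0`, and
`f` a `C¹` function of the ambient matrix coordinates `Edge → (Fin N → Fin N → ℂ)`.  Then there is a `C¹` function
`g` of the ambient coordinates with `𝔼 f(coords U^x_t) = g(coords x)` for every group configuration `x`: the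
transition operator `P_t` preserves `C¹` cylinder functions. [folklore] -/
theorem markovTransition_contDiff_one [NeZero L] (β : ℝ)
    {Ω : Type} [MeasurableSpace Ω] {P : Measure Ω} [IsProbabilityMeasure P]
    {W : ℝ≥0 → Ω → (Edge 3 L × NoiseIdx 2 → ℝ)} (hW : IsFlatBrownian W P)
    (B U : GaugeConfig 3 L (Matrix.specialUnitaryGroup (Fin 2) ℂ) → ℝ≥0 → Ω →
      GaugeConfig 3 L (Matrix.specialUnitaryGroup (Fin 2) ℂ))
    (hB : ∀ x, (∀ ω, B x 0 ω = x) ∧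
      (latticeLangevinDynamics (fundamentalLatticeRep 2) 0).IsSolution (fundamentalRep (Fin 2)) hW.natFiltration P W (B x))
    (hBm : ∀ i : ℝ≥0, Measurable[@Prod.instMeasurableSpace (Set.Iic i)
        (GaugeConfig 3 L (Matrix.specialUnitaryGroup (Fin 2) ℂ) × Ω) inferInstance
        (@Prod.instMeasurableSpace (GaugeConfig 3 L (Matrix.specialUnitaryGroup (Fin 2) ℂ)) Ω inferInstance
          (hW.natFiltration i))]
      (fun q : Set.Iic i × (GaugeConfig 3 L (Matrix.specialUnitaryGroup (Fin 2) ℂ) × Ω) => B q.2.1 q.1 q.2.2))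
    (hU : ∀ x, (∀ ω, U x 0 ω = x) ∧
      (latticeLangevinDynamics (fundamentalLatticeRep 2) β).IsSolution (fundamentalRep (Fin 2)) hW.natFiltration P W (U x))
    (hUm : ∀ i : ℝ≥0, Measurable[@Prod.instMeasurableSpace (Set.Iic i)
        (GaugeConfig 3 L (Matrix.specialUnitaryGroup (Fin 2) ℂ) × Ω) inferInstance
        (@Prod.instMeasurableSpace (GaugeConfig 3 L (Matrix.specialUnitaryGroup (Fin 2) ℂ)) Ω inferInstance
          (hW.natFiltration i))]
      (fun q : Set.Iic i × (GaugeConfig 3 L (Matrix.specialUnitaryGroup (Fin 2) ℂ) × Ω) => U q.2.1 q.1 q.2.2))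
    (t : ℝ≥0) {f : (Edge 3 L → Fin (fundamentalLatticeRep 2).N → Fin (fundamentalLatticeRep 2).N → ℂ) → ℝ}
    (hf : ContDiff ℝ 1 f) :
    ∃ g : (Edge 3 L → Fin (fundamentalLatticeRep 2).N → Fin (fundamentalLatticeRep 2).N → ℂ) → ℝ,
      ContDiff ℝ 1 g ∧
      ∀ x : GaugeConfig 3 L (Matrix.specialUnitaryGroup (Fin 2) ℂ),
        ∫ ω, f (fun (e : Edge 3 L) (k l : Fin (fundamentalLatticeRep 2).N) =>
            (fundamentalLatticeRep 2).ρ (U x t ω e) k l) ∂P =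
          g (fun (e : Edge 3 L) (k l : Fin (fundamentalLatticeRep 2).N) => (fundamentalLatticeRep 2).ρ (x e) k l) := by
  classical
  let Cfg : Type := Edge 3 L → Fin (fundamentalLatticeRep 2).N → Fin (fundamentalLatticeRep 2).N → ℂ
  obtain ⟨coords, hcoords⟩ : ∃ coords : GaugeConfig 3 L (Matrix.specialUnitaryGroup (Fin 2) ℂ) → Cfg,
      coords = fun x e k l => (fundamentalLatticeRep 2).ρ (x e) k l := ⟨_, rfl⟩
  have hcoords_c : Continuous coords := by rw [hcoords]; exact continuous_coordsRho (L := L)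
  have hcoords1 : ∀ x, ‖coords x‖ ≤ 1 := fun x => by rw [hcoords]; exact norm_frame_config_le_one (L := L) x
  have hmU : ∀ x u, Measurable (U x u) := fun x u => ((hU x).2.adapted u).mono (hW.natFiltration.le u) le_rfl
  -- (1) tamed field, (2) retraction
  obtain ⟨G, hG, hGF, K, hK0, hK1, hK2⟩ := exists_tamed_dossSussmannField (L := L) β
  have hGc : Continuous G := hG.continuous
  obtain ⟨R, U₀, χ, hU₀, hxU₀', hRx', hRs', hχs, hχx', hχ0⟩ := exists_smooth_retraction L
  have hxU₀ : ∀ x, coords x ∈ U₀ := fun x => by rw [hcoords]; exact hxU₀' x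
  have hRx : ∀ x, R (coords x) = x := fun x => by rw [hcoords]; exact hRx' x
  have hRs : ContDiffOn ℝ (⊤ : ℕ∞) (fun M => coords (R M)) U₀ := by rw [hcoords]; exact hRs'
  have hχx : ∀ x, χ (coords x) = 1 := fun x => by rw [hcoords]; exact hχx' x
  set T : ℝ := (t : ℝ) with hTdef
  have hT0 : 0 ≤ T := t.2
  -- (3) frame paths
  obtain ⟨craw, hcraw⟩ : ∃ craw : Ω → I → Cfg,
      craw = fun ω (τ : I) e k l => (fundamentalLatticeRep 2).ρ (B 1 (T * (τ : ℝ)).toNNReal ω e) k l := ⟨_, rfl⟩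
  have hcraw1 : ∀ ω τ, ‖craw ω τ‖ ≤ 1 := fun ω τ => by
    rw [hcraw]; exact norm_frame_config_le_one (L := L) (fun e => B 1 (T * (τ : ℝ)).toNNReal ω e)
  obtain ⟨c, hc⟩ : ∃ c : Ω → C(I, Cfg), c = fun ω =>
      if h : Continuous (craw ω) then ⟨craw ω, h⟩ else ContinuousMap.const I (craw ω 0) := ⟨_, rfl⟩
  have hc1 : ∀ ω τ, ‖c ω τ‖ ≤ 1 := by
    intro ω τ
    rw [hc]
    by_cases h : Continuous (craw ω)
    · simp only [h, dif_pos]; exact hcraw1 ω τ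
    · simp only [h, dif_neg, not_false_eq_true, ContinuousMap.const_apply]; exact hcraw1 ω 0
  -- (4) flows, (5) left multiplications
  choose Φ hΦeq hΦuniq hΦs hΦder hΦdisp using fun ω => exists_dossSussmannFlow hG hK0 hK1 hK2 hT0 (c ω) (hc1 ω)
  choose Lp hLp hLpn using fun ω =>
    (exists_leftMul_clm (L := L) (craw ω 1) : ∃ Lp : Cfg →L[ℝ] Cfg,
      (∀ V, Lp V = fun (e : Edge 3 L) (k l : Fin (fundamentalLatticeRep 2).N) =>
        (Matrix.of (craw ω 1 e) * Matrix.of (V e)) k l) ∧ ‖Lp‖ ≤ 2 * ‖craw ω 1‖)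
  have hLp2 : ∀ ω, ‖Lp ω‖ ≤ 2 := fun ω =>
    calc ‖Lp ω‖ ≤ 2 * ‖craw ω 1‖ := hLpn ω
      _ ≤ 2 * 1 := by gcongr; exact hcraw1 ω 1
      _ = 2 := by norm_num
  -- (6) the retraction in coordinates, the flow at time one, the integrand
  obtain ⟨cR, hcR⟩ : ∃ cR : Cfg → Cfg, cR = fun M => coords (R M) := ⟨_, rfl⟩
  have hcR1 : ∀ M, ‖cR M‖ ≤ 1 := fun M => by rw [hcR]; exact hcoords1 (R M)
  have hcRs : ContDiffOn ℝ (⊤ : ℕ∞) cR U₀ := by rw [hcR]; exact hRs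
  have hcRc : ContinuousOn cR U₀ := hcRs.continuousOn
  have hcRd : ∀ M ∈ U₀, HasFDerivAt cR (fderiv ℝ cR M) M := fun M hM =>
    ((hcRs.differentiableOn (by simp)).differentiableAt (hU₀.mem_nhds hM)).hasFDerivAt
  have hcRfc : ContinuousOn (fderiv ℝ cR) U₀ := hcRs.continuousOn_fderiv_of_isOpen hU₀ (by simp)
  obtain ⟨Φ1, hΦ1⟩ : ∃ Φ1 : Ω → Cfg → Cfg, Φ1 = fun ω y => Φ ω y 1 := ⟨_, rfl⟩
  have hΦ1s : ∀ ω, ContDiff ℝ (⊤ : ℕ∞) (Φ1 ω) := fun ω => by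
    rw [hΦ1]; exact (ContinuousMap.evalCLM ℝ (1 : I) (M := Cfg)).contDiff.comp (hΦs ω)
  have hΦ1d : ∀ ω, Differentiable ℝ (Φ1 ω) := fun ω => (hΦ1s ω).differentiable (by simp)
  have hΦ1fc : ∀ ω, Continuous (fderiv ℝ (Φ1 ω)) := fun ω => (hΦ1s ω).continuous_fderiv (by simp)
  have hΦ1b : ∀ ω y, ‖fderiv ℝ (Φ1 ω) y‖ ≤ Real.exp (T * K) := fun ω y => by
    have h := hΦder ω y 1
    rw [Set.Icc.coe_one, mul_one] at h
    rw [hΦ1]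
    exact h
  have hΦ1n : ∀ ω y, ‖Φ1 ω y‖ ≤ ‖y‖ + T * K := fun ω y => by
    have h := hΦdisp ω y 1
    simp only [Set.Icc.coe_one, mul_one] at h
    rw [hΦ1]
    calc ‖Φ ω y 1‖ = ‖(Φ ω y 1 - y) + y‖ := by rw [sub_add_cancel]
      _ ≤ ‖Φ ω y 1 - y‖ + ‖y‖ := norm_add_le _ _
      _ ≤ T * K + ‖y‖ := by gcongr
      _ = ‖y‖ + T * K := add_comm _ _
  obtain ⟨F, hF⟩ : ∃ F : Cfg → Ω → ℝ, F = fun M ω => f (Lp ω (Φ1 ω (cR M))) := ⟨_, rfl⟩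
  -- the range of the inner point is bounded, uniformly in `ω`
  have hrange : ∀ ω M, Lp ω (Φ1 ω (cR M)) ∈ closedBall (0 : Cfg) (2 * (1 + T * K)) := by
    intro ω M
    refine mem_closedBall_zero_iff.2 ?_
    calc ‖Lp ω (Φ1 ω (cR M))‖ ≤ ‖Lp ω‖ * ‖Φ1 ω (cR M)‖ := (Lp ω).le_opNorm _
      _ ≤ 2 * (1 + T * K) :=
          mul_le_mul (hLp2 ω) ((hΦ1n ω _).trans (by linarith [hcR1 M])) (norm_nonneg _) (by norm_num)
  obtain ⟨Cf, hCf⟩ := (isCompact_closedBall (0 : Cfg) (2 * (1 + T * K))).exists_bound_of_continuousOn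
    ((hf.continuous_fderiv one_ne_zero).continuousOn)
  obtain ⟨Cf0, hCf0⟩ := (isCompact_closedBall (0 : Cfg) (2 * (1 + T * K))).exists_bound_of_continuousOn
    (hf.continuous.continuousOn)
  have hCfnn : 0 ≤ Cf := (norm_nonneg _).trans (hCf _ (mem_closedBall_self (by positivity)))
  -- (7) the a.s. identity `f(coords U^{R M}_t) = F M`
  have hae : ∀ M, (fun ω => f (coords (U (R M) t ω))) =ᵐ[P] F M := by
    intro M
    filter_upwards [dossSussmann_flow_representation (L := L) β hGc hGF hW B U hB hBm hU hUm 1 (R M) hT0]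
      with ω hω
    obtain ⟨hcont, hrep⟩ := hω
    have hcω_cont : Continuous (craw ω) := by rw [hcraw]; exact hcont
    have hcω : c ω = ⟨craw ω, hcω_cont⟩ := by rw [hc]; exact dif_pos hcω_cont
    have huniq := hΦuniq ω
    rw [hcω] at huniq
    subst hcraw
    have key := hrep (Φ ω) huniq 1
    have ht1 : (T * ((1 : I) : ℝ)).toNNReal = t := by simp [hTdef]
    -- the start: `(ρ1)ᴴ ρ(R M) = coords (R M)`
    have hstart : (fun (e : Edge 3 L) (k l : Fin (fundamentalLatticeRep 2).N) =>
        (((fundamentalLatticeRep 2).ρ ((1 : GaugeConfig 3 L (Matrix.specialUnitaryGroup (Fin 2) ℂ)) e))ᴴ *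
          (fundamentalLatticeRep 2).ρ (R M e)) k l) = cR M := by
      rw [hcR, hcoords]; funext e k l
      have h1e : (1 : GaugeConfig 3 L (Matrix.specialUnitaryGroup (Fin 2) ℂ)) e = 1 := rfl
      show (((fundamentalLatticeRep 2).ρ ((1 : GaugeConfig 3 L (Matrix.specialUnitaryGroup (Fin 2) ℂ)) e))ᴴ *
          (fundamentalLatticeRep 2).ρ (R M e)) k l = (fundamentalLatticeRep 2).ρ (R M e) k l
      rw [h1e, map_one, Matrix.conjTranspose_one, Matrix.one_mul]
    rw [hstart] at key
    rw [hF]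
    show f (coords (U (R M) t ω)) = f (Lp ω (Φ1 ω (cR M)))
    congr 1
    rw [hLp ω, hΦ1, hcoords]
    funext e k l
    rw [← ht1]
    show ((fundamentalLatticeRep 2).ρ (U (R M) (T * ((1 : I) : ℝ)).toNNReal ω e)) k l = _
    rw [key e]
    rfl
  -- measurability and integrability of the integrand
  have hFmeas : ∀ M, AEStronglyMeasurable (F M) P := fun M =>
    (((hf.continuous.comp hcoords_c).measurable.comp (hmU (R M) t)).aestronglyMeasurable).congr (hae M)
  have hFbdd : ∀ M ω, ‖F M ω‖ ≤ Cf0 := fun M ω => by rw [hF]; exact hCf0 _ (hrange ω M)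
  have hFint : ∀ M, Integrable (F M) P := fun M =>
    Integrable.of_bound (hFmeas M) Cf0 (ae_of_all _ fun ω => hFbdd M ω)
  -- (8) the derivative of the integrand in `M`, for every `ω`
  obtain ⟨F', hF'⟩ : ∃ F' : Cfg → Ω → (Cfg →L[ℝ] ℝ), F' = fun M ω =>
      (fderiv ℝ f (Lp ω (Φ1 ω (cR M)))).comp
        ((Lp ω).comp ((fderiv ℝ (Φ1 ω) (cR M)).comp (fderiv ℝ cR M))) := ⟨_, rfl⟩
  have hderiv : ∀ ω, ∀ M ∈ U₀, HasFDerivAt (fun M => F M ω) (F' M ω) M := by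
    intro ω M hM
    rw [hF, hF']
    have h2 : HasFDerivAt (Φ1 ω) (fderiv ℝ (Φ1 ω) (cR M)) (cR M) := (hΦ1d ω _).hasFDerivAt
    have h3 : HasFDerivAt (Lp ω) (Lp ω) (Φ1 ω (cR M)) := (Lp ω).hasFDerivAt
    have h4 : HasFDerivAt f (fderiv ℝ f (Lp ω (Φ1 ω (cR M)))) (Lp ω (Φ1 ω (cR M))) :=
      (hf.differentiable one_ne_zero _).hasFDerivAt
    exact h4.comp M (h3.comp M (h2.comp M (hcRd M hM)))
  have hF'bound : ∀ ω, ∀ M ∈ U₀, ‖F' M ω‖ ≤ Cf * (2 * (Real.exp (T * K) * ‖fderiv ℝ cR M‖)) := by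
    intro ω M hM
    rw [hF']
    refine (ContinuousLinearMap.opNorm_comp_le _ _).trans ?_
    refine mul_le_mul (hCf _ (hrange ω M)) ?_ (norm_nonneg _) hCfnn
    refine (ContinuousLinearMap.opNorm_comp_le _ _).trans ?_
    refine mul_le_mul (hLp2 ω) ?_ (norm_nonneg _) (by norm_num)
    refine (ContinuousLinearMap.opNorm_comp_le _ _).trans ?_
    exact mul_le_mul_of_nonneg_right (hΦ1b ω _) (norm_nonneg _)
  have hF'meas : ∀ M ∈ U₀, AEStronglyMeasurable (F' M) P := fun M hM =>
    aestronglyMeasurable_fderiv_param hFmeas fun ω => hderiv ω M hM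
  have hF'cont : ∀ ω, ContinuousOn (fun M => F' M ω) U₀ := by
    intro ω
    rw [hF']
    have hin : ContinuousOn (fun M => Lp ω (Φ1 ω (cR M))) U₀ :=
      ((Lp ω).continuous.comp (hΦ1s ω).continuous).comp_continuousOn hcRc
    have hA : ContinuousOn (fun M => fderiv ℝ f (Lp ω (Φ1 ω (cR M)))) U₀ :=
      (hf.continuous_fderiv one_ne_zero).comp_continuousOn hin
    have hB : ContinuousOn (fun M => fderiv ℝ (Φ1 ω) (cR M)) U₀ := (hΦ1fc ω).comp_continuousOn hcRc
    exact hA.clm_comp (continuousOn_const.clm_comp (hB.clm_comp hcRfc))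
  -- (9) differentiation under the expectation
  obtain ⟨h, hh⟩ : ∃ h : Cfg → ℝ, h = fun M => ∫ ω, F M ω ∂P := ⟨_, rfl⟩
  have hHas : ∀ M₀ ∈ U₀, HasFDerivAt h (∫ ω, F' M₀ ω ∂P) M₀ ∧
      ContinuousAt (fun M => ∫ ω, F' M ω ∂P) M₀ := by
    intro M₀ hM₀
    obtain ⟨ε, hε, hball⟩ := Metric.isOpen_iff.1 hU₀ M₀ hM₀
    have hε2 : 0 < ε / 2 := half_pos hε
    have hcb : closedBall M₀ (ε / 2) ⊆ U₀ := (closedBall_subset_ball (half_lt_self hε)).trans hball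
    have hbU : ball M₀ (ε / 2) ⊆ U₀ := ball_subset_closedBall.trans hcb
    obtain ⟨CR, hCR⟩ := (isCompact_closedBall M₀ (ε / 2)).exists_bound_of_continuousOn (hcRfc.mono hcb)
    set C : ℝ := Cf * (2 * (Real.exp (T * K) * CR)) with hC
    have hbd : ∀ ω, ∀ M ∈ ball M₀ (ε / 2), ‖F' M ω‖ ≤ C := by
      intro ω M hM
      refine (hF'bound ω M (hbU hM)).trans ?_
      have := hCR M (ball_subset_closedBall hM)
      rw [hC]
      gcongr
    refine ⟨?_, ?_⟩
    · rw [hh]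
      exact hasFDerivAt_integral_of_dominated_of_fderiv_le (ball_mem_nhds M₀ hε2)
        (Eventually.of_forall hFmeas) (hFint M₀) (hF'meas M₀ hM₀) (ae_of_all _ (hbd ·))
        (integrable_const C) (ae_of_all _ fun ω M hM => hderiv ω M (hbU hM))
    · have hco : ContinuousOn (fun M => ∫ ω, F' M ω ∂P) (ball M₀ (ε / 2)) :=
        continuousOn_of_dominated (fun M hM => hF'meas M (hbU hM))
          (fun M hM => ae_of_all _ fun ω => hbd ω M hM) (integrable_const C)
          (ae_of_all _ fun ω => (hF'cont ω).mono hbU)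
      exact hco.continuousAt (ball_mem_nhds M₀ hε2)
  have hdiffOn : DifferentiableOn ℝ h U₀ := fun M hM => (hHas M hM).1.differentiableAt.differentiableWithinAt
  have hfd : ∀ M ∈ U₀, fderiv ℝ h M = ∫ ω, F' M ω ∂P := fun M hM => (hHas M hM).1.fderiv
  have hcontfd : ContinuousOn (fderiv ℝ h) U₀ := by
    intro M hM
    have hev : fderiv ℝ h =ᶠ[𝓝 M] fun M => ∫ ω, F' M ω ∂P :=
      Filter.eventuallyEq_of_mem (hU₀.mem_nhds hM) fun M' hM' => hfd M' hM'
    exact ((hHas M hM).2.congr_of_eventuallyEq hev).continuousWithinAt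
  have hC1 : ContDiffOn ℝ 1 h U₀ := by
    rw [show (1 : WithTop ℕ∞) = 0 + 1 from (zero_add 1).symm]
    exact (contDiffOn_succ_iff_fderiv_of_isOpen (𝕜 := ℝ) (E := Cfg) (F := ℝ) (n := 0) (f := h) (s := U₀) hU₀).2
      ⟨hdiffOn, fun h0 => absurd h0 (by simp), contDiffOn_zero.2 hcontfd⟩
  -- (10) gluing with the cut-off
  refine ⟨fun M => χ M * h M, contDiff_mul_of_eventuallyEq_zero hU₀ hC1 (hχs.of_le (by exact_mod_cast le_top)) hχ0,
    fun x => ?_⟩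
  have hχ1 : χ (coords x) = 1 := hχx x
  have hR : R (coords x) = x := hRx x
  have hcx : coords x = fun (e : Edge 3 L) (k l : Fin (fundamentalLatticeRep 2).N) =>
      (fundamentalLatticeRep 2).ρ (x e) k l := by rw [hcoords]
  show _ = χ _ * h _
  rw [← hcx, hχ1, one_mul, hh]
  show _ = ∫ ω, F (coords x) ω ∂P
  rw [← integral_congr_ae (hae (coords x)), hR, hcoords]

end Summit.QuantumFields.YangMills.Theorems.ColdStartUniversality

end
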